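/-
Copyright (c) 2026 the pub-hodgecm-mathlib formalisation cell (harness21).  Prover seats hodgecm-mathlib-K2E3-p25 (g4) (pen of record, LEAD F0P6-plan (g14) BATCH
#171 (1)) and hodgecm-mathlib-K2E3-p31 (g2) (draft 372f80e40a682d40 of §1–§2, BATCH #164 (1) ∕ #170 (A)), Track B «K2-LIT» ∕ hLiu418 #184♮ = `stmt-HodgeConjecture-24832`,
F4 road (E), (E-d) pivot, input (R-grp) FILE (iii) = THE HEAD: the RIGHT LEG `k ↦ 1_𝔻 ⊗ k` of the see-saw pair at ONE REAL PLACE —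
«`partnerEmb (k̂ σ k) = ((placeSec_𝕎 σ (relabel (toBig (1, k)))), 1)`» (the right-leg twin of ★ K2E5-p16 FILE 2b-2 `K2LiuArchTensorPlaceSec.tensorEmb_archToAdelic_placeSec`)
and its junction form «`partnerEmb (k̂ σ (kV k)) = archEmb (placeSecJ_𝕎 σ eP′ eQ′ (toBig (κ (1, k)), 1))`» in the bytes of ★ p863344 `K2LiuArchSWPivotOfRecord` (letter `hkk`).
Desks K2Liu-p27 (g2) (F4), consumer LH7-p07 (g2) (B3-b (π1)) ∕ K2Liu-p27 `K2LiuArchSWPivotDischarge`, K2Liu-p26 ((R-scal), (R-det)).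
THEOREMS ONLY (no `def`, no `instance`, no notation, no named-fact hypothesis, no `sorry`).
-/
import Summits.HodgeConjecture.HodgeConjecture.Theorems.K2LiuArchPartnerEmbArchComponent   -- ★ FILE (i) (K2E3-p31): `coe_archAt_archPart_partnerEmb`, `partnerEmb_archToAdelic`
import Summits.HodgeConjecture.HodgeConjecture.Theorems.K2LiuArchTensorFrameChaseRight      -- ★ FILE (ii) (K2E3-p31): `reindex_signSplit_scaleConj_one_tensor` (+ ★ FILE 2b-2, FILE 1)
import Summits.HodgeConjecture.HodgeConjecture.Theorems.K2LiuArchSectionPlaceJunction       -- ★ `placeSecJ`, `placeSecJ_inl`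
import Summits.HodgeConjecture.HodgeConjecture.Theorems.K2LiuArchOneParameterOrbitDefs      -- ★ `archEmb` (= `archToAdelic`, `rfl`)
import Literature.NumberTheory.Weil1964.ArchFollandDualPairDefinitePlaceSlice              -- ★ `toUFormEquiv`, `toUForm_toUFormEquiv_symm`, `wOf_injective`
import Literature.NumberTheory.Automorphic.UnitaryGroupArchSection                         -- ★ `UnitaryGroup.adelicSingle`, `archAt_archPart_adelicSingle`, `archAt_archSingle_of_ne`
import HarnessLib

/-!
# Crux `HLiu418`, F4 (E-d) pivot, (R-grp): `1_𝔻 ⊗ k̂_σ(k) = placeSec_𝕎 σ (relabel (eP, eQ) (toBig (1, k)))` — the right leg of the see-saw pair at one real place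

Cell `hodgecm-mathlib`, crux item hLiu418 = `stmt-HodgeConjecture-24832` (helper lane `--supports`, count-neutral; closes no socket).

THE SOCKET.  The (E-d) pivot of F4 (F4 desk K2Liu-p27 (g2) 23:42:50Z; ★ (P-arch) p863113 `K2LiuArchRightLegPlacePin`, ★ (R-scal) p863266 `K2LiuRightLegVacuumScalarMatch`,
B3-b assembly LH7-p07 (g2)) reads the Siegel–Weil section of `𝕎 = 𝔻 ⊗ V′` along the RIGHT leg `k ↦ 1_𝔻 ⊗ k` at a real place `σ`: (P-arch) puts the section at
`H′ · archEmb (placeSecJ_𝕎 σ eP eQ (toBig (κ (1, k)), 1))`, and the SW-law ★ `swSectionTensor_omega_partnerEmb_eq_mul` needs that element IN THE IMAGE OF ★ `partnerEmb`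
(★ p861304, `k ↦ reindex epsD (1 ⊗ₖ k)`).  THIS FILE supplies the group identity (R-grp), the twin of ★ K2E5-p16's (J2⊗-arch) left-leg chain (FILE 1 ∕ 2a ∕ 2b):

THE `y`-FRAME (design note, K2 bus 23:55:59Z).  The junction frame of record (★ `K2LiuArchJunctionFrameData.exists_junctionFrameData`, ★ J0) indexes `V′_σ` by the RAW real
vector `y = σ ∘ dV′` (`hz`: `signVec_𝕎 = signVec_𝔻 · y`), NOT by ★ `signVec`'s `y ∕ c_σ` (`c_σ = im σ_w(i)`, sign uncontrolled) — so the partner's local element is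
placed by the generic ★ `toUFormEquiv` with sign frame `signSplit y`, scaling `√|y|` and phase constant `1` (§1 `formCongr_yFrame`: `diag(√|y|)ᴴ · signForm · diag(√|y|) =
σ_w(diag dV′)`), and made adelic by ★ `UnitaryGroup.adelicSingle` at `w(σ) = cmPlaceOver L σ`:
`k̂ σ k := adelicSingle_{V′} (cmPlaceOver L σ) ((toUFormEquiv (signSplit y) _ one_ne_zero (formCongr_yFrame …)).symm k)` for `k ∈ U(PosIdx y, NegIdx y)` (printed ONCE, §2;
no `def`: the term is explicit in every head).
* §1 `ht_yFrame`, `diagonal_partner_eq_map`, **`formCongr_yFrame`** — the Sylvester identity of the `y`-frame of `V′_σ`.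
* §2 **`archUFormPi_partnerEmb_kHat_self`** — the `σ`-component: `archUFormPi_𝕎 ((1 ⊗ k̂ σ k)_∞) σ = relabel eP eQ (toBig (1, k))` (★ FILE (i) `coe_archAt_archPart_partnerEmb`
  + ★ `archAt_archPart_adelicSingle` + FILE (ii) `reindex_signSplit_scaleConj_one_tensor` + ★ `toUForm_toUFormEquiv_symm` + ★ `coe_toBig` ∕ `UForm.coe_relabel`);
  **`archUFormPi_partnerEmb_kHat_of_ne`** — every other component is `1` (★ `archAt_archSingle_of_ne`);
  **`archPart_partnerEmb_kHat`** — `(1 ⊗ k̂ σ k)_∞ = placeSec_𝕎 σ (relabel eP eQ (toBig (1, k)))` (★ `archUFormPi_injective_cm` + ★ `archUFormPi_placeSec_self ∕ _of_ne`);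
  **`partnerEmb_kHat`** — THE ADELIC HEAD (R-grp): `partnerEmb (k̂ σ k) = archToAdelic_𝕎 (placeSec_𝕎 σ (relabel eP eQ (toBig (1, k))))` (FILE (i) `partnerEmb_archToAdelic`).
The frame letters `(y, hy, hz, eP, eQ, hE)` are ★ FILE 2b-2's VERBATIM plus ONE: `hyσ : ∀ k, σ(dV′ k) = y k` (the junction frame of record has `y σ k := σ(dV′ k)`, so
`hyσ := fun _ => rfl` there).
* §3 **`partnerEmb_kHat_eq_archEmb_placeSecJ_κ`** — THE JUNCTION FORM, letter `hkk` of ★ p863344 `K2LiuArchSWPivotOfRecord.swSection_junctionSlot_κOp_eq_vacScalar_mul` BY THE BYTE: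
  `partnerEmb (k̂ σ (kV k)) = archEmb_𝕎 (placeSecJ_𝕎 σ eP′ eQ′ (toBig P Q (PosIdx y) (NegIdx y) (κ P Q _ _ (1, k)), 1))` for abstract small blocks `P, Q` relabelled into the sign blocks
  of `𝔻_σ` by `eSp : P ≃ 𝔻⁺_σ`, `eSq : Q ≃ 𝔻⁻_σ` and the junction frame `eP′ := eP⁻¹ ≫ (eSp⁻¹ × 1 ⊕ eSq⁻¹ × 1)`, `eQ′ := eQ⁻¹ ≫ (eSp⁻¹ × 1 ⊕ eSq⁻¹ × 1)` of ★
  `K2LiuArchJunctionFrameData.hsec_placeSec_relabel` (★ `archEmb_eq_archToAdelic` + ★ `placeSecJ_inl` + the sixteen-block relabel identity `relabel_symm_toBig_one` + `κ_one_left`).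
Statements at `maxHeartbeats 4000000` (the CM sign frames of the big datum; measured on the ★ twins).
References: [KonnoKonno2007] §3.1 (3.1); [Kudla1994] §2; [HarrisKudlaSweet1996] §1 (1.8); [BorelJacquet1979] §4.1; [MoeglinVignerasWaldspurger1987] Ch. 1 I.17;
[PlatonovRapinchuk1994] §2.3.
HONEST LABEL: HC_CM is proved only modulo the 7 printed citations (2 remaining named inputs: hLiu418 = stmt-HodgeConjecture-24832,
h413 = stmt-HodgeConjecture-24833) until rung 0 closes; count-neutral helper, closes no socket.
-/

set_option autoImplicit false
set_option linter.dupNamespace false -- the mandated namespace repeats `HodgeConjecture.HodgeConjecture`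
set_option synthInstance.maxSize 512 -- `DecidableEq` of the nested block index `DPIdx ((P×R)⊕(Q×S)) ((P×S)⊕(Q×R)) Unit Empty` (structural; as ★ (P-arch) ∕ ★ FrameData)

noncomputable section

open scoped Matrix Kronecker Classical
open NumberField NumberField.InfinitePlace NumberField.mixedEmbedding IsDedekindDomain

namespace Summit.HodgeConjecture.HodgeConjecture.Cruxes.HLiu418.K2LiuArchPlaceSecJPartnerEmb

open Literature.NumberTheory.Automorphic Literature.NumberTheory.Automorphic.UnitaryGroup Literature.NumberTheory.Weil1964
open Literature.NumberTheory.GelbartRogawski1991 Literature.NumberTheory.GelbartRogawski1991.UnitaryDualPair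
open Literature.NumberTheory.GelbartRogawski1991.UnitaryDualPair.LocalSplitting
open Literature.NumberTheory.GelbartRogawski1991.GRConstruction Literature.NumberTheory.K2Lit.SiegelDoubled
open Literature.RepresentationTheory.HeisenbergGroup Literature.Analysis.SegalBargmann
open Literature.RepresentationTheory.KonnoKonno2007 Literature.RepresentationTheory.KonnoKonno2007.RealDualPair
open Summit.HodgeConjecture.HodgeConjecture.Cruxes.HLiu418 Summit.HodgeConjecture.HodgeConjecture.Cruxes.HLiu418.K2LiuArchSectionPlaceBlock
open Summit.HodgeConjecture.HodgeConjecture.Cruxes.HLiu418.K2LiuPartnerEmbedding (partnerEmb)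

variable (L : Type) [Field L] [NumberField L] [IsCMField L]
variable {N M n : ℕ} (e : Fin N × Fin M ≃ Fin n)
  (dV : Fin N → L) (hdV : ∀ i, IsCMField.complexConj L (dV i) = dV i)
  (dW : Fin M → L) (hdW : ∀ i, IsCMField.complexConj L (dW i) = dW i)
variable {M₂ M' n' : ℕ} (eW : Fin M × Fin M₂ ≃ Fin M') (e' : Fin N × Fin M' ≃ Fin n')
  (dV' : Fin M₂ → L) (hdV' : ∀ k, IsCMField.complexConj L (dV' k) = dV' k)

/-! ## §1 The Sylvester identity of the `y`-frame of `V′_σ` -/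

omit [NumberField L] [IsCMField L] in
/-- `y j = 1 · signOf(signSplit y j) · (√|y j|)²` — the `ht` letter of ★ `formCongr_scaleGL_smul_signForm` ∕ ★ `archUForm` for the RAW sign frame `(signSplit y, √|y|)` with phase
constant `1`. [folklore] -/
theorem ht_yFrame {m : ℕ} (y : Fin m → ℝ) (hy : ∀ k, y k ≠ 0) (t : Fin m → ℝ) (hty : ∀ k, t k = y k) (j : Fin m) :
    t j = 1 * signOf (signSplit y j) * sqrtAbs y j ^ 2 := by
  rw [hty, one_mul, sqrtAbs_sq, signOf_signSplit_mul_abs y j (hy j)]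

/-- `diag(dV′) = diag(dV′|_{L⁺}) ⊗ 1` — the `hJ` letter of ★ `archLocalForm_diagonal` for the partner datum `J = Matrix.diagonal dV′` (real entries). [folklore] -/
theorem diagonal_partner_eq_map :
    Matrix.diagonal dV' =
      (Matrix.diagonal fun k => (⟨dV' k, (IsCMField.complexConj_eq_self_iff (K := L) (dV' k)).1 (hdV' _)⟩ : Fp L)).map (algebraMap (Fp L) L) := by
  rw [Matrix.diagonal_map (map_zero _)]
  rfl

/-- **THE `y`-FRAME SYLVESTER IDENTITY OF `V′_σ`**: for `y = σ ∘ dV′`, `diag(√|y|)ᴴ · (1 • signForm (PosIdx y) (NegIdx y))^{signSplit y} · diag(√|y|) = σ_{w(σ)}(diag dV′)` — the `hH` letter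
of ★ `toUFormEquiv` placing `U(V′)(L⁺ ⊗ ℝ)_{w(σ)}` in the RAW sign frame of the junction frame of record (★ `formCongr_scaleGL_smul_signForm` + ★ `archLocalForm_diagonal`).
[cite: PlatonovRapinchuk1994, §2.3] [cite: BorelJacquet1979, §4.1] -/
theorem formCongr_yFrame (σ : {v : InfinitePlace (Fp L) // v.IsReal}) (y : Fin M₂ → ℝ) (hy : ∀ k, y k ≠ 0)
    (hyσ : ∀ k, embedding_of_isReal σ.2 (⟨dV' k, (IsCMField.complexConj_eq_self_iff (K := L) (dV' k)).1 (hdV' _)⟩ : Fp L) = y k) :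
    formCongr (starRingEnd ℂ) (scaleGL (sqrtAbs y) (fun j => sqrtAbs_ne_zero (hy j)))
        ((((1 : ℝ) : ℂ) • signForm (PosIdx y) (NegIdx y)).submatrix (signSplit y) (signSplit y)) =
      (Matrix.diagonal dV').map (cmPlaceOver L σ).1.embedding :=
  (formCongr_scaleGL_smul_signForm (signSplit y) (fun j => sqrtAbs_ne_zero (hy j)) 1
      (ht_yFrame y hy (fun k => embedding_of_isReal σ.2
        (⟨dV' k, (IsCMField.complexConj_eq_self_iff (K := L) (dV' k)).1 (hdV' _)⟩ : Fp L)) hyσ)).trans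
    (archLocalForm_diagonal L (IsCMField.complexConj L) M₂ (IsCMField.complexConj_ne_one L) (cmPlaceOver L) (cmPlaceOver_smul L)
      (cmPlaceOver_comap L) _ (diagonal_partner_eq_map L dV' hdV') σ).symm

/-! ## §2 The right leg at one real place: `1 ⊗ k̂ σ k` component by component, then adelically -/

-- the CM sign frames of the big datum elaborate slowly (as ★ FILE 2b-2 ∕ ★ σ15 ∕ ★ 3-b: 4 000 000 heartbeats)
set_option maxHeartbeats 4000000

/-- **THE `σ`-COMPONENT**: in the sign frame at `σ`, `(1 ⊗ k̂ σ k)_∞` read through `archUFormPi_𝕎` IS `relabel eP eQ (toBig (1, k))` for every frame identification `(eP, eQ)`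
compatible with the two sign splittings through `dpEquiv` (★ `sumCongr_tensorEquiv_compatible`: ★ J0's is), where — PRINTED ONCE —
`k̂ σ k := adelicSingle_{V′} (cmPlaceOver L σ) ((toUFormEquiv (signSplit y) _ one_ne_zero (formCongr_yFrame …)).symm k)` (★ `coe_archUForm` + FILE (i) `coe_archAt_archPart_partnerEmb`
+ ★ `archAt_archPart_adelicSingle` + FILE (ii) `reindex_signSplit_scaleConj_one_tensor` + ★ `toUForm_toUFormEquiv_symm` + ★ `coe_toBig` ∕ `UForm.coe_relabel`).
[cite: KonnoKonno2007, §3.1 (3.1)] [cite: Kudla1994, §2 (doubled space, Siegel parabolic)] [cite: BorelJacquet1979, §4.1] -/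
theorem archUFormPi_partnerEmb_kHat_self (hdV0 : ∀ i, dV i ≠ 0) (hdW0 : ∀ i, dW i ≠ 0) (hdV'0 : ∀ k, dV' k ≠ 0)
    (σ : {v : InfinitePlace (Fp L) // v.IsReal}) (y : Fin M₂ → ℝ) (hy : ∀ k, y k ≠ 0)
    (hyσ : ∀ k, embedding_of_isReal σ.2 (⟨dV' k, (IsCMField.complexConj_eq_self_iff (K := L) (dV' k)).1 (hdV' _)⟩ : Fp L) = y k)
    (hz : ∀ j, signVec (cmPlaceOver L) (fun k => Sum.elim (cmGramEntry L e' dV hdV (tensorFrame L dW eW dV') (tensorFrame_real L dW hdW eW dV' hdV')) (-cmGramEntry L e' dV hdV (tensorFrame L dW eW dV') (tensorFrame_real L dW hdW eW dV' hdV')) ((e₂ n').symm k)) (imagUnit L) σ j =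
      signVec (cmPlaceOver L) (fun k => Sum.elim (cmGramEntry L e dV hdV dW hdW) (-cmGramEntry L e dV hdV dW hdW) ((e₂ n).symm k)) (imagUnit L) σ ((epsD e eW e').symm j).1 * y ((epsD e eW e').symm j).2)
    (eP : (PosIdx (signVec (cmPlaceOver L) (fun k => Sum.elim (cmGramEntry L e dV hdV dW hdW) (-cmGramEntry L e dV hdV dW hdW) ((e₂ n).symm k)) (imagUnit L) σ) × PosIdx y) ⊕
        (NegIdx (signVec (cmPlaceOver L) (fun k => Sum.elim (cmGramEntry L e dV hdV dW hdW) (-cmGramEntry L e dV hdV dW hdW) ((e₂ n).symm k)) (imagUnit L) σ) × NegIdx y) ≃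
      PosIdx (signVec (cmPlaceOver L) (fun k => Sum.elim (cmGramEntry L e' dV hdV (tensorFrame L dW eW dV') (tensorFrame_real L dW hdW eW dV' hdV')) (-cmGramEntry L e' dV hdV (tensorFrame L dW eW dV') (tensorFrame_real L dW hdW eW dV' hdV')) ((e₂ n').symm k)) (imagUnit L) σ))
    (eQ : (PosIdx (signVec (cmPlaceOver L) (fun k => Sum.elim (cmGramEntry L e dV hdV dW hdW) (-cmGramEntry L e dV hdV dW hdW) ((e₂ n).symm k)) (imagUnit L) σ) × NegIdx y) ⊕
        (NegIdx (signVec (cmPlaceOver L) (fun k => Sum.elim (cmGramEntry L e dV hdV dW hdW) (-cmGramEntry L e dV hdV dW hdW) ((e₂ n).symm k)) (imagUnit L) σ) × PosIdx y) ≃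
      NegIdx (signVec (cmPlaceOver L) (fun k => Sum.elim (cmGramEntry L e' dV hdV (tensorFrame L dW eW dV') (tensorFrame_real L dW hdW eW dV' hdV')) (-cmGramEntry L e' dV hdV (tensorFrame L dW eW dV') (tensorFrame_real L dW hdW eW dV' hdV')) ((e₂ n').symm k)) (imagUnit L) σ))
    (hE : ∀ i, (dpEquiv _ _ _ _).symm ((eP.sumCongr eQ).symm i) =
      (signSplit (signVec (cmPlaceOver L) (fun k => Sum.elim (cmGramEntry L e dV hdV dW hdW) (-cmGramEntry L e dV hdV dW hdW) ((e₂ n).symm k)) (imagUnit L) σ)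
        ((epsD e eW e').symm ((signSplit (signVec (cmPlaceOver L) (fun k => Sum.elim (cmGramEntry L e' dV hdV (tensorFrame L dW eW dV') (tensorFrame_real L dW hdW eW dV' hdV')) (-cmGramEntry L e' dV hdV (tensorFrame L dW eW dV') (tensorFrame_real L dW hdW eW dV' hdV')) ((e₂ n').symm k)) (imagUnit L) σ)).symm i)).1,
       signSplit y ((epsD e eW e').symm ((signSplit (signVec (cmPlaceOver L) (fun k => Sum.elim (cmGramEntry L e' dV hdV (tensorFrame L dW eW dV') (tensorFrame_real L dW hdW eW dV' hdV')) (-cmGramEntry L e' dV hdV (tensorFrame L dW eW dV') (tensorFrame_real L dW hdW eW dV' hdV')) ((e₂ n').symm k)) (imagUnit L) σ)).symm i)).2))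
    (kk : UForm (PosIdx y) (NegIdx y)) :
    archUFormPi L (IsCMField.complexConj L) (n' + n') (IsCMField.complexConj_ne_one L) (cmPlaceOver L) (cmPlaceOver_smul L) (cmPlaceOver_comap L) _
        (gramD_gram_realDiagonal_entry_ne_zero L e' dV hdV (tensorFrame L dW eW dV') (tensorFrame_real L dW hdW eW dV' hdV') hdV0 (tensorFrame_ne_zero L dW eW dV' hdW0 hdV'0))
        (gramD_eq_diagonal_cm L e' dV hdV (tensorFrame L dW eW dV') (tensorFrame_real L dW hdW eW dV' hdV'))
        (J := hermD L e' dV hdV (tensorFrame L dW eW dV') (tensorFrame_real L dW hdW eW dV' hdV')) rfl (complexConj_imagUnit L) (imagUnit_ne_zero L)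
        (UnitaryGroup.archPart (Fp L) L (IsCMField.complexConj L) (n' + n') (hermD L e' dV hdV (tensorFrame L dW eW dV') (tensorFrame_real L dW hdW eW dV' hdV'))
          (partnerEmb L e dV hdV dW hdW eW e' dV' hdV' (UnitaryGroup.adelicSingle (Fp L) L (IsCMField.complexConj L) M₂ (Matrix.diagonal dV') (IsCMField.complexConj_ne_one L)
              (complexConj_smul_infinitePlace L) (cmPlaceOver L σ) ((toUFormEquiv (signSplit y) (fun j => sqrtAbs_ne_zero (hy j)) one_ne_zero (formCongr_yFrame L dV' hdV' σ y hy hyσ)).symm kk)))) σ =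
      UForm.relabel _ _ _ _ eP eQ (toBig _ _ (PosIdx y) (NegIdx y) (1, kk)) := by
  apply Subtype.ext
  apply Units.ext
  rw [archUFormPi_apply, coe_archUForm, UnitaryGroup.archPart_archToAdelic,
    K2LiuArchPartnerEmbArchComponent.coe_archAt_archPart_partnerEmb, UnitaryGroup.archAt_archPart_adelicSingle]
  -- the `V′` side: `reindex (signSplit y) (scaleConj √|y| (toUFormEquiv⁻¹ kk)) = matrix kk`
  have hM := congrArg (fun g : UForm (PosIdx y) (NegIdx y) => (((g : UForm (PosIdx y) (NegIdx y)) : GL (PosIdx y ⊕ NegIdx y) ℂ) :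
      Matrix (PosIdx y ⊕ NegIdx y) (PosIdx y ⊕ NegIdx y) ℂ))
    (toUForm_toUFormEquiv_symm (signSplit y) (fun j => sqrtAbs_ne_zero (hy j)) one_ne_zero (formCongr_yFrame L dV' hdV' σ y hy hyσ) kk)
  simp only [coe_toUForm] at hM
  rw [K2LiuArchTensorFrameChaseRight.reindex_signSplit_scaleConj_one_tensor _ y (epsD e eW e') _ _
      (sqrtAbs_signVec_ne_zero (IsCMField.complexConj_ne_one L) (cmPlaceOver_smul L) (complexConj_imagUnit L) (imagUnit_ne_zero L)
        (gramD_gram_realDiagonal_entry_ne_zero L e dV hdV dW hdW hdV0 hdW0) σ)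
      (sqrtAbs y) _ (K2LiuArchTensorPlaceSecMatrix.sqrtAbs_tensor _ _ (epsD e eW e') _ hz) _ (eP.sumCongr eQ) hE,
    hM, UForm.coe_relabel, coe_toBig]
  simp

/-- **OFF THE PLACE `σ`**: for `v ≠ σ`, the `v`-component of `(1 ⊗ k̂ σ k)_∞` in the sign frame is `1` (★ `archAt_archSingle_of_ne`, `reindex epsD (1 ⊗ₖ 1) = 1`, `scaleConj D 1 = 1`).
[cite: BorelJacquet1979, §4.1] -/
theorem archUFormPi_partnerEmb_kHat_of_ne (hdV0 : ∀ i, dV i ≠ 0) (hdW0 : ∀ i, dW i ≠ 0) (hdV'0 : ∀ k, dV' k ≠ 0)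
    (σ : {v : InfinitePlace (Fp L) // v.IsReal}) {v : {v : InfinitePlace (Fp L) // v.IsReal}} (hv : v ≠ σ)
    (y : Fin M₂ → ℝ) (hy : ∀ k, y k ≠ 0)
    (hyσ : ∀ k, embedding_of_isReal σ.2 (⟨dV' k, (IsCMField.complexConj_eq_self_iff (K := L) (dV' k)).1 (hdV' _)⟩ : Fp L) = y k)
    (kk : UForm (PosIdx y) (NegIdx y)) :
    archUFormPi L (IsCMField.complexConj L) (n' + n') (IsCMField.complexConj_ne_one L) (cmPlaceOver L) (cmPlaceOver_smul L) (cmPlaceOver_comap L) _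
        (gramD_gram_realDiagonal_entry_ne_zero L e' dV hdV (tensorFrame L dW eW dV') (tensorFrame_real L dW hdW eW dV' hdV') hdV0 (tensorFrame_ne_zero L dW eW dV' hdW0 hdV'0))
        (gramD_eq_diagonal_cm L e' dV hdV (tensorFrame L dW eW dV') (tensorFrame_real L dW hdW eW dV' hdV'))
        (J := hermD L e' dV hdV (tensorFrame L dW eW dV') (tensorFrame_real L dW hdW eW dV' hdV')) rfl (complexConj_imagUnit L) (imagUnit_ne_zero L)
        (UnitaryGroup.archPart (Fp L) L (IsCMField.complexConj L) (n' + n') (hermD L e' dV hdV (tensorFrame L dW eW dV') (tensorFrame_real L dW hdW eW dV' hdV'))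
          (partnerEmb L e dV hdV dW hdW eW e' dV' hdV' (UnitaryGroup.adelicSingle (Fp L) L (IsCMField.complexConj L) M₂ (Matrix.diagonal dV') (IsCMField.complexConj_ne_one L)
              (complexConj_smul_infinitePlace L) (cmPlaceOver L σ) ((toUFormEquiv (signSplit y) (fun j => sqrtAbs_ne_zero (hy j)) one_ne_zero (formCongr_yFrame L dV' hdV' σ y hy hyσ)).symm kk)))) v = 1 := by
  have hne : cmPlaceOver L v ≠ cmPlaceOver L σ := fun h' => hv (wOf_injective (cmPlaceOver_comap L) h')
  apply Subtype.ext
  apply Units.ext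
  rw [archUFormPi_apply, coe_archUForm, UnitaryGroup.archPart_archToAdelic,
    K2LiuArchPartnerEmbArchComponent.coe_archAt_archPart_partnerEmb, UnitaryGroup.archPart_adelicSingle,
    UnitaryGroup.archAt_archSingle_of_ne (Fp L) L (IsCMField.complexConj L) M₂ (Matrix.diagonal dV') (IsCMField.complexConj_ne_one L)
      (complexConj_smul_infinitePlace L) (cmPlaceOver L σ) hne]
  simp only [OneMemClass.coe_one, Units.val_one, Matrix.one_kronecker_one, Matrix.reindex_apply, Matrix.submatrix_one_equiv,
    K2LiuArchTensorPlaceSec.scaleConj_one' (sqrtAbs_signVec_ne_zero (IsCMField.complexConj_ne_one L) (cmPlaceOver_smul L) (complexConj_imagUnit L)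
      (imagUnit_ne_zero L) (gramD_gram_realDiagonal_entry_ne_zero L e' dV hdV (tensorFrame L dW eW dV') (tensorFrame_real L dW hdW eW dV' hdV') hdV0
        (tensorFrame_ne_zero L dW eW dV' hdW0 hdV'0)) v)]

/-- **(R-grp) AT THE ARCHIMEDEAN GROUP**: `(1 ⊗ k̂ σ k)_∞ = placeSec_𝕎 σ (relabel eP eQ (toBig (1, k)))` — `1 ⊗ K_{V′,w(σ)} ⊆ K_𝕎` at the group level, in Konno–Konno's junction frame
(§2 `_self` ∕ `_of_ne` against ★ `archUFormPi_placeSec_self ∕ _of_ne`, ★ `archUFormPi_injective_cm`). [cite: KonnoKonno2007, §3.1 (3.1)] [cite: Kudla1994, §2] [cite: HarrisKudlaSweet1996, §1 (1.8)] -/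
theorem archPart_partnerEmb_kHat (hdV0 : ∀ i, dV i ≠ 0) (hdW0 : ∀ i, dW i ≠ 0) (hdV'0 : ∀ k, dV' k ≠ 0)
    (σ : {v : InfinitePlace (Fp L) // v.IsReal}) (y : Fin M₂ → ℝ) (hy : ∀ k, y k ≠ 0)
    (hyσ : ∀ k, embedding_of_isReal σ.2 (⟨dV' k, (IsCMField.complexConj_eq_self_iff (K := L) (dV' k)).1 (hdV' _)⟩ : Fp L) = y k)
    (hz : ∀ j, signVec (cmPlaceOver L) (fun k => Sum.elim (cmGramEntry L e' dV hdV (tensorFrame L dW eW dV') (tensorFrame_real L dW hdW eW dV' hdV')) (-cmGramEntry L e' dV hdV (tensorFrame L dW eW dV') (tensorFrame_real L dW hdW eW dV' hdV')) ((e₂ n').symm k)) (imagUnit L) σ j =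
      signVec (cmPlaceOver L) (fun k => Sum.elim (cmGramEntry L e dV hdV dW hdW) (-cmGramEntry L e dV hdV dW hdW) ((e₂ n).symm k)) (imagUnit L) σ ((epsD e eW e').symm j).1 * y ((epsD e eW e').symm j).2)
    (eP : (PosIdx (signVec (cmPlaceOver L) (fun k => Sum.elim (cmGramEntry L e dV hdV dW hdW) (-cmGramEntry L e dV hdV dW hdW) ((e₂ n).symm k)) (imagUnit L) σ) × PosIdx y) ⊕
        (NegIdx (signVec (cmPlaceOver L) (fun k => Sum.elim (cmGramEntry L e dV hdV dW hdW) (-cmGramEntry L e dV hdV dW hdW) ((e₂ n).symm k)) (imagUnit L) σ) × NegIdx y) ≃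
      PosIdx (signVec (cmPlaceOver L) (fun k => Sum.elim (cmGramEntry L e' dV hdV (tensorFrame L dW eW dV') (tensorFrame_real L dW hdW eW dV' hdV')) (-cmGramEntry L e' dV hdV (tensorFrame L dW eW dV') (tensorFrame_real L dW hdW eW dV' hdV')) ((e₂ n').symm k)) (imagUnit L) σ))
    (eQ : (PosIdx (signVec (cmPlaceOver L) (fun k => Sum.elim (cmGramEntry L e dV hdV dW hdW) (-cmGramEntry L e dV hdV dW hdW) ((e₂ n).symm k)) (imagUnit L) σ) × NegIdx y) ⊕
        (NegIdx (signVec (cmPlaceOver L) (fun k => Sum.elim (cmGramEntry L e dV hdV dW hdW) (-cmGramEntry L e dV hdV dW hdW) ((e₂ n).symm k)) (imagUnit L) σ) × PosIdx y) ≃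
      NegIdx (signVec (cmPlaceOver L) (fun k => Sum.elim (cmGramEntry L e' dV hdV (tensorFrame L dW eW dV') (tensorFrame_real L dW hdW eW dV' hdV')) (-cmGramEntry L e' dV hdV (tensorFrame L dW eW dV') (tensorFrame_real L dW hdW eW dV' hdV')) ((e₂ n').symm k)) (imagUnit L) σ))
    (hE : ∀ i, (dpEquiv _ _ _ _).symm ((eP.sumCongr eQ).symm i) =
      (signSplit (signVec (cmPlaceOver L) (fun k => Sum.elim (cmGramEntry L e dV hdV dW hdW) (-cmGramEntry L e dV hdV dW hdW) ((e₂ n).symm k)) (imagUnit L) σ)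
        ((epsD e eW e').symm ((signSplit (signVec (cmPlaceOver L) (fun k => Sum.elim (cmGramEntry L e' dV hdV (tensorFrame L dW eW dV') (tensorFrame_real L dW hdW eW dV' hdV')) (-cmGramEntry L e' dV hdV (tensorFrame L dW eW dV') (tensorFrame_real L dW hdW eW dV' hdV')) ((e₂ n').symm k)) (imagUnit L) σ)).symm i)).1,
       signSplit y ((epsD e eW e').symm ((signSplit (signVec (cmPlaceOver L) (fun k => Sum.elim (cmGramEntry L e' dV hdV (tensorFrame L dW eW dV') (tensorFrame_real L dW hdW eW dV' hdV')) (-cmGramEntry L e' dV hdV (tensorFrame L dW eW dV') (tensorFrame_real L dW hdW eW dV' hdV')) ((e₂ n').symm k)) (imagUnit L) σ)).symm i)).2))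
    (kk : UForm (PosIdx y) (NegIdx y)) :
    UnitaryGroup.archPart (Fp L) L (IsCMField.complexConj L) (n' + n')
        (hermD L e' dV hdV (tensorFrame L dW eW dV') (tensorFrame_real L dW hdW eW dV' hdV'))
        (partnerEmb L e dV hdV dW hdW eW e' dV' hdV'
          (UnitaryGroup.adelicSingle (Fp L) L (IsCMField.complexConj L) M₂ (Matrix.diagonal dV') (IsCMField.complexConj_ne_one L)
            (complexConj_smul_infinitePlace L) (cmPlaceOver L σ)
            ((toUFormEquiv (signSplit y) (fun j => sqrtAbs_ne_zero (hy j)) one_ne_zero (formCongr_yFrame L dV' hdV' σ y hy hyσ)).symm kk))) =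
      placeSec L (IsCMField.complexConj L) (n' + n') (IsCMField.complexConj_ne_one L) (cmPlaceOver L) (cmPlaceOver_smul L) _
        (gramD_gram_realDiagonal_entry_ne_zero L e' dV hdV (tensorFrame L dW eW dV') (tensorFrame_real L dW hdW eW dV' hdV') hdV0 (tensorFrame_ne_zero L dW eW dV' hdW0 hdV'0))
        (complexConj_imagUnit L) (imagUnit_ne_zero L) σ (cmPlaceOver_comap L)
        (gramD_eq_diagonal_cm L e' dV hdV (tensorFrame L dW eW dV') (tensorFrame_real L dW hdW eW dV' hdV'))
        (J := hermD L e' dV hdV (tensorFrame L dW eW dV') (tensorFrame_real L dW hdW eW dV' hdV')) rfl (complexConj_smul_infinitePlace L)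
        (UForm.relabel _ _ _ _ eP eQ (toBig _ _ (PosIdx y) (NegIdx y) (1, kk))) := by
  refine K2LiuArchTensorPlaceSec.archUFormPi_injective_cm L
    (fun k => Sum.elim (cmGramEntry L e' dV hdV (tensorFrame L dW eW dV') (tensorFrame_real L dW hdW eW dV' hdV'))
      (-cmGramEntry L e' dV hdV (tensorFrame L dW eW dV') (tensorFrame_real L dW hdW eW dV' hdV')) ((e₂ n').symm k))
    (gramD_gram_realDiagonal_entry_ne_zero L e' dV hdV (tensorFrame L dW eW dV') (tensorFrame_real L dW hdW eW dV' hdV') hdV0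
      (tensorFrame_ne_zero L dW eW dV' hdW0 hdV'0))
    (gramD_eq_diagonal_cm L e' dV hdV (tensorFrame L dW eW dV') (tensorFrame_real L dW hdW eW dV' hdV')) rfl (funext fun v => ?_)
  by_cases hv : v = σ
  · subst hv
    exact (archUFormPi_partnerEmb_kHat_self L e dV hdV dW hdW eW e' dV' hdV' hdV0 hdW0 hdV'0 v y hy hyσ hz eP eQ hE kk).trans
      (archUFormPi_placeSec_self L (IsCMField.complexConj L) (n' + n') (IsCMField.complexConj_ne_one L) (cmPlaceOver L) (cmPlaceOver_smul L) _
        (gramD_gram_realDiagonal_entry_ne_zero L e' dV hdV (tensorFrame L dW eW dV') (tensorFrame_real L dW hdW eW dV' hdV') hdV0 (tensorFrame_ne_zero L dW eW dV' hdW0 hdV'0))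
        (complexConj_imagUnit L) (imagUnit_ne_zero L) v (cmPlaceOver_comap L)
        (gramD_eq_diagonal_cm L e' dV hdV (tensorFrame L dW eW dV') (tensorFrame_real L dW hdW eW dV' hdV')) rfl
        (complexConj_smul_infinitePlace L) _).symm
  · exact (archUFormPi_partnerEmb_kHat_of_ne L e dV hdV dW hdW eW e' dV' hdV' hdV0 hdW0 hdV'0 σ hv y hy hyσ kk).trans
      (archUFormPi_placeSec_of_ne L (IsCMField.complexConj L) (n' + n') (IsCMField.complexConj_ne_one L) (cmPlaceOver L) (cmPlaceOver_smul L) _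
        (gramD_gram_realDiagonal_entry_ne_zero L e' dV hdV (tensorFrame L dW eW dV') (tensorFrame_real L dW hdW eW dV' hdV') hdV0 (tensorFrame_ne_zero L dW eW dV' hdW0 hdV'0))
        (complexConj_imagUnit L) (imagUnit_ne_zero L) σ (cmPlaceOver_comap L)
        (gramD_eq_diagonal_cm L e' dV hdV (tensorFrame L dW eW dV') (tensorFrame_real L dW hdW eW dV' hdV')) rfl
        (complexConj_smul_infinitePlace L) hv _).symm

/-- **(R-grp), ADELIC FORM — THE RIGHT LEG OF THE SEE-SAW PAIR AT ONE REAL PLACE LIES IN THE IMAGE OF `partnerEmb`**: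
`partnerEmb (k̂ σ k) = archToAdelic_𝕎 (placeSec_𝕎 σ (relabel eP eQ (toBig (1, k))))`, `k̂ σ k := adelicSingle_{V′} (cmPlaceOver L σ) ((toUFormEquiv (signSplit y) _ one_ne_zero
(formCongr_yFrame …)).symm k)` (FILE (i) `partnerEmb_archToAdelic` + the previous theorem).  (P-arch)'s `archEmb (placeSecJ σ eP′ eQ′ (toBig (κ (1,k)), 1))` is this element through ★
`archEmb_eq_archToAdelic`, ★ `placeSecJ_inl` and the relabel algebra of ★ `K2LiuArchJunctionFrameData` §2 (the consumer's bridge, as on the left leg).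
[cite: KonnoKonno2007, §3.1 (3.1)] [cite: Kudla1994, §2 (doubled space, Siegel parabolic)] [cite: HarrisKudlaSweet1996, §1 (1.8)] [cite: MoeglinVignerasWaldspurger1987, Ch. 1 I.17] -/
theorem partnerEmb_kHat (hdV0 : ∀ i, dV i ≠ 0) (hdW0 : ∀ i, dW i ≠ 0) (hdV'0 : ∀ k, dV' k ≠ 0)
    (σ : {v : InfinitePlace (Fp L) // v.IsReal}) (y : Fin M₂ → ℝ) (hy : ∀ k, y k ≠ 0)
    (hyσ : ∀ k, embedding_of_isReal σ.2 (⟨dV' k, (IsCMField.complexConj_eq_self_iff (K := L) (dV' k)).1 (hdV' _)⟩ : Fp L) = y k)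
    (hz : ∀ j, signVec (cmPlaceOver L) (fun k => Sum.elim (cmGramEntry L e' dV hdV (tensorFrame L dW eW dV') (tensorFrame_real L dW hdW eW dV' hdV')) (-cmGramEntry L e' dV hdV (tensorFrame L dW eW dV') (tensorFrame_real L dW hdW eW dV' hdV')) ((e₂ n').symm k)) (imagUnit L) σ j =
      signVec (cmPlaceOver L) (fun k => Sum.elim (cmGramEntry L e dV hdV dW hdW) (-cmGramEntry L e dV hdV dW hdW) ((e₂ n).symm k)) (imagUnit L) σ ((epsD e eW e').symm j).1 * y ((epsD e eW e').symm j).2)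
    (eP : (PosIdx (signVec (cmPlaceOver L) (fun k => Sum.elim (cmGramEntry L e dV hdV dW hdW) (-cmGramEntry L e dV hdV dW hdW) ((e₂ n).symm k)) (imagUnit L) σ) × PosIdx y) ⊕
        (NegIdx (signVec (cmPlaceOver L) (fun k => Sum.elim (cmGramEntry L e dV hdV dW hdW) (-cmGramEntry L e dV hdV dW hdW) ((e₂ n).symm k)) (imagUnit L) σ) × NegIdx y) ≃
      PosIdx (signVec (cmPlaceOver L) (fun k => Sum.elim (cmGramEntry L e' dV hdV (tensorFrame L dW eW dV') (tensorFrame_real L dW hdW eW dV' hdV')) (-cmGramEntry L e' dV hdV (tensorFrame L dW eW dV') (tensorFrame_real L dW hdW eW dV' hdV')) ((e₂ n').symm k)) (imagUnit L) σ))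
    (eQ : (PosIdx (signVec (cmPlaceOver L) (fun k => Sum.elim (cmGramEntry L e dV hdV dW hdW) (-cmGramEntry L e dV hdV dW hdW) ((e₂ n).symm k)) (imagUnit L) σ) × NegIdx y) ⊕
        (NegIdx (signVec (cmPlaceOver L) (fun k => Sum.elim (cmGramEntry L e dV hdV dW hdW) (-cmGramEntry L e dV hdV dW hdW) ((e₂ n).symm k)) (imagUnit L) σ) × PosIdx y) ≃
      NegIdx (signVec (cmPlaceOver L) (fun k => Sum.elim (cmGramEntry L e' dV hdV (tensorFrame L dW eW dV') (tensorFrame_real L dW hdW eW dV' hdV')) (-cmGramEntry L e' dV hdV (tensorFrame L dW eW dV') (tensorFrame_real L dW hdW eW dV' hdV')) ((e₂ n').symm k)) (imagUnit L) σ))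
    (hE : ∀ i, (dpEquiv _ _ _ _).symm ((eP.sumCongr eQ).symm i) =
      (signSplit (signVec (cmPlaceOver L) (fun k => Sum.elim (cmGramEntry L e dV hdV dW hdW) (-cmGramEntry L e dV hdV dW hdW) ((e₂ n).symm k)) (imagUnit L) σ)
        ((epsD e eW e').symm ((signSplit (signVec (cmPlaceOver L) (fun k => Sum.elim (cmGramEntry L e' dV hdV (tensorFrame L dW eW dV') (tensorFrame_real L dW hdW eW dV' hdV')) (-cmGramEntry L e' dV hdV (tensorFrame L dW eW dV') (tensorFrame_real L dW hdW eW dV' hdV')) ((e₂ n').symm k)) (imagUnit L) σ)).symm i)).1,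
       signSplit y ((epsD e eW e').symm ((signSplit (signVec (cmPlaceOver L) (fun k => Sum.elim (cmGramEntry L e' dV hdV (tensorFrame L dW eW dV') (tensorFrame_real L dW hdW eW dV' hdV')) (-cmGramEntry L e' dV hdV (tensorFrame L dW eW dV') (tensorFrame_real L dW hdW eW dV' hdV')) ((e₂ n').symm k)) (imagUnit L) σ)).symm i)).2))
    (kk : UForm (PosIdx y) (NegIdx y)) :
    partnerEmb L e dV hdV dW hdW eW e' dV' hdV'
        (UnitaryGroup.adelicSingle (Fp L) L (IsCMField.complexConj L) M₂ (Matrix.diagonal dV') (IsCMField.complexConj_ne_one L)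
          (complexConj_smul_infinitePlace L) (cmPlaceOver L σ)
          ((toUFormEquiv (signSplit y) (fun j => sqrtAbs_ne_zero (hy j)) one_ne_zero (formCongr_yFrame L dV' hdV' σ y hy hyσ)).symm kk)) =
      UnitaryGroup.archToAdelic (Fp L) L (IsCMField.complexConj L) (n' + n')
        (hermD L e' dV hdV (tensorFrame L dW eW dV') (tensorFrame_real L dW hdW eW dV' hdV'))
        (placeSec L (IsCMField.complexConj L) (n' + n') (IsCMField.complexConj_ne_one L) (cmPlaceOver L) (cmPlaceOver_smul L) _
          (gramD_gram_realDiagonal_entry_ne_zero L e' dV hdV (tensorFrame L dW eW dV') (tensorFrame_real L dW hdW eW dV' hdV') hdV0 (tensorFrame_ne_zero L dW eW dV' hdW0 hdV'0))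
          (complexConj_imagUnit L) (imagUnit_ne_zero L) σ (cmPlaceOver_comap L)
          (gramD_eq_diagonal_cm L e' dV hdV (tensorFrame L dW eW dV') (tensorFrame_real L dW hdW eW dV' hdV'))
          (J := hermD L e' dV hdV (tensorFrame L dW eW dV') (tensorFrame_real L dW hdW eW dV' hdV')) rfl (complexConj_smul_infinitePlace L)
          (UForm.relabel _ _ _ _ eP eQ (toBig _ _ (PosIdx y) (NegIdx y) (1, kk)))) := by
  rw [UnitaryGroup.adelicSingle_apply, K2LiuArchPartnerEmbArchComponent.partnerEmb_archToAdelic, ← UnitaryGroup.adelicSingle_apply,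
    archPart_partnerEmb_kHat L e dV hdV dW hdW eW e' dV' hdV' hdV0 hdW0 hdV'0 σ y hy hyσ hz eP eQ hE kk]

/-! ## §3 The junction form: letter `hkk` of ★ `K2LiuArchSWPivotOfRecord` by the byte -/

section Junction

variable {P Q R S P₀ Q₀ P'' Q'' : Type} [Fintype P] [DecidableEq P] [Fintype Q] [DecidableEq Q] [Fintype R] [DecidableEq R] [Fintype S] [DecidableEq S]
  [Fintype P₀] [DecidableEq P₀] [Fintype Q₀] [DecidableEq Q₀] [Fintype P''] [DecidableEq P''] [Fintype Q''] [DecidableEq Q'']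

/-- **`toBig (1, ·)` IS NATURAL UNDER RELABELLING THE SMALL BLOCKS OF THE FIRST MEMBER** (the `(1, u)` slot twin of ★ `K2LiuArchJunctionFrameData.relabel_relabel_toBig_relabel`): for
`eSp : P ≃ P₀`, `eSq : Q ≃ Q₀`, a frame `(eP, eQ)` of the big blocks of `(P₀, Q₀; R, S)` and the induced junction frame `eP′ := eP⁻¹ ≫ (eSp⁻¹ × 1 ⊕ eSq⁻¹ × 1)`,
`eQ′ := eQ⁻¹ ≫ (eSp⁻¹ × 1 ⊕ eSq⁻¹ × 1)`: `(relabel eP′ eQ′)⁻¹ (toBig P Q R S (1, u)) = relabel eP eQ (toBig P₀ Q₀ R S (1, u))` (matrices: `reindex`ed Kronecker products `1 ⊗ u`,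
entry by entry on the sixteen blocks). [cite: KonnoKonno2007, §3.1 (3.1)] [cite: MoeglinVignerasWaldspurger1987, Ch. 1 I.17] -/
theorem relabel_symm_toBig_one (eSp : P ≃ P₀) (eSq : Q ≃ Q₀) (eP : (P₀ × R) ⊕ (Q₀ × S) ≃ P'') (eQ : (P₀ × S) ⊕ (Q₀ × R) ≃ Q'') (u : UForm R S) :
    (UForm.relabel P'' Q'' ((P × R) ⊕ (Q × S)) ((P × S) ⊕ (Q × R))
        (eP.symm.trans (Equiv.sumCongr (eSp.symm.prodCongr (Equiv.refl R)) (eSq.symm.prodCongr (Equiv.refl S))))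
        (eQ.symm.trans (Equiv.sumCongr (eSp.symm.prodCongr (Equiv.refl S)) (eSq.symm.prodCongr (Equiv.refl R))))).symm
        (toBig P Q R S (1, u)) =
      UForm.relabel ((P₀ × R) ⊕ (Q₀ × S)) ((P₀ × S) ⊕ (Q₀ × R)) P'' Q'' eP eQ (toBig P₀ Q₀ R S (1, u)) := by
  rw [ContinuousMulEquiv.symm_apply_eq]
  apply Subtype.ext
  apply Units.ext
  rw [UForm.coe_relabel, UForm.coe_relabel, coe_toBig, coe_toBig]
  ext i j
  simp only [OneMemClass.coe_one, Units.val_one, Matrix.reindex_apply, Matrix.submatrix_apply, Matrix.kroneckerMap_apply, Equiv.sumCongr_symm,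
    Equiv.sumCongr_apply]
  rcases i with ((⟨a, r⟩ | ⟨b, s⟩) | (⟨a, s⟩ | ⟨b, r⟩)) <;> rcases j with ((⟨a', r'⟩ | ⟨b', s'⟩) | (⟨a', s'⟩ | ⟨b', r'⟩)) <;>
    simp [Equiv.prodCongr_apply, dpEquiv_symm_inl_inl, dpEquiv_symm_inl_inr, dpEquiv_symm_inr_inl, dpEquiv_symm_inr_inr, Matrix.one_apply]

/-- `κ (1, k) = (1, kV k)` — Konno–Konno's `κ = kV × kV` on a pair with trivial first member. [cite: KonnoKonno2007, §3.1] -/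
theorem κ_one_left (k : Matrix.unitaryGroup R ℂ × Matrix.unitaryGroup S ℂ) :
    κ P Q R S ((1 : Matrix.unitaryGroup P ℂ × Matrix.unitaryGroup Q ℂ), k) = (1, UForm.kV R S k) :=
  Prod.ext (map_one (UForm.kV P Q)) rfl

end Junction

/-- **(R-grp), JUNCTION FORM — THE LETTER `hkk` OF ★ `K2LiuArchSWPivotOfRecord.swSection_junctionSlot_κOp_eq_vacScalar_mul` BY THE BYTE**: for abstract small blocks `P, Q`
relabelled into the sign blocks of `𝔻_σ` by `eSp : P ≃ 𝔻⁺_σ`, `eSq : Q ≃ 𝔻⁻_σ` (`P = Q = Fin n` in the model, or `Equiv.refl`), the partner blocks `R, S := PosIdx y, NegIdx y` of the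
RAW frame, the junction frame `eP′ := eP⁻¹ ≫ (eSp⁻¹ × 1 ⊕ eSq⁻¹ × 1)`, `eQ′ := eQ⁻¹ ≫ (eSp⁻¹ × 1 ⊕ eSq⁻¹ × 1)` of ★ `K2LiuArchJunctionFrameData.hsec_placeSec_relabel`, and every
`k = (c, d) ∈ U(R) × U(S)`:
`partnerEmb (k̂ σ (kV k)) = archEmb_𝕎 (placeSecJ_𝕎 σ eP′ eQ′ (toBig P Q R S (κ P Q R S (1, k)), 1))`, `k̂ σ u := adelicSingle_{V′} (cmPlaceOver L σ) ((toUFormEquiv (signSplit y) _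
one_ne_zero (formCongr_yFrame …)).symm u)` — so `kk := fun k => k̂ σ (kV k)` discharges `hkk` with zero glue (★ `archEmb_eq_archToAdelic` (`rfl`) + ★ `placeSecJ_inl` + `κ_one_left` +
`relabel_symm_toBig_one` + §2 `partnerEmb_kHat`). [cite: KonnoKonno2007, §3.1 (3.1)] [cite: Kudla1994, §2 (doubled space, Siegel parabolic)] [cite: HarrisKudlaSweet1996, §1 (1.8)]
[cite: BorelJacquet1979, §4.1] -/
theorem partnerEmb_kHat_eq_archEmb_placeSecJ_κ (hdV0 : ∀ i, dV i ≠ 0) (hdW0 : ∀ i, dW i ≠ 0) (hdV'0 : ∀ k, dV' k ≠ 0)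
    (σ : {v : InfinitePlace (Fp L) // v.IsReal}) (y : Fin M₂ → ℝ) (hy : ∀ k, y k ≠ 0)
    (hyσ : ∀ k, embedding_of_isReal σ.2 (⟨dV' k, (IsCMField.complexConj_eq_self_iff (K := L) (dV' k)).1 (hdV' _)⟩ : Fp L) = y k)
    (hz : ∀ j, signVec (cmPlaceOver L) (fun k => Sum.elim (cmGramEntry L e' dV hdV (tensorFrame L dW eW dV') (tensorFrame_real L dW hdW eW dV' hdV')) (-cmGramEntry L e' dV hdV (tensorFrame L dW eW dV') (tensorFrame_real L dW hdW eW dV' hdV')) ((e₂ n').symm k)) (imagUnit L) σ j =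
      signVec (cmPlaceOver L) (fun k => Sum.elim (cmGramEntry L e dV hdV dW hdW) (-cmGramEntry L e dV hdV dW hdW) ((e₂ n).symm k)) (imagUnit L) σ ((epsD e eW e').symm j).1 * y ((epsD e eW e').symm j).2)
    (eP : (PosIdx (signVec (cmPlaceOver L) (fun k => Sum.elim (cmGramEntry L e dV hdV dW hdW) (-cmGramEntry L e dV hdV dW hdW) ((e₂ n).symm k)) (imagUnit L) σ) × PosIdx y) ⊕
        (NegIdx (signVec (cmPlaceOver L) (fun k => Sum.elim (cmGramEntry L e dV hdV dW hdW) (-cmGramEntry L e dV hdV dW hdW) ((e₂ n).symm k)) (imagUnit L) σ) × NegIdx y) ≃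
      PosIdx (signVec (cmPlaceOver L) (fun k => Sum.elim (cmGramEntry L e' dV hdV (tensorFrame L dW eW dV') (tensorFrame_real L dW hdW eW dV' hdV')) (-cmGramEntry L e' dV hdV (tensorFrame L dW eW dV') (tensorFrame_real L dW hdW eW dV' hdV')) ((e₂ n').symm k)) (imagUnit L) σ))
    (eQ : (PosIdx (signVec (cmPlaceOver L) (fun k => Sum.elim (cmGramEntry L e dV hdV dW hdW) (-cmGramEntry L e dV hdV dW hdW) ((e₂ n).symm k)) (imagUnit L) σ) × NegIdx y) ⊕
        (NegIdx (signVec (cmPlaceOver L) (fun k => Sum.elim (cmGramEntry L e dV hdV dW hdW) (-cmGramEntry L e dV hdV dW hdW) ((e₂ n).symm k)) (imagUnit L) σ) × PosIdx y) ≃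
      NegIdx (signVec (cmPlaceOver L) (fun k => Sum.elim (cmGramEntry L e' dV hdV (tensorFrame L dW eW dV') (tensorFrame_real L dW hdW eW dV' hdV')) (-cmGramEntry L e' dV hdV (tensorFrame L dW eW dV') (tensorFrame_real L dW hdW eW dV' hdV')) ((e₂ n').symm k)) (imagUnit L) σ))
    (hE : ∀ i, (dpEquiv _ _ _ _).symm ((eP.sumCongr eQ).symm i) =
      (signSplit (signVec (cmPlaceOver L) (fun k => Sum.elim (cmGramEntry L e dV hdV dW hdW) (-cmGramEntry L e dV hdV dW hdW) ((e₂ n).symm k)) (imagUnit L) σ)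
        ((epsD e eW e').symm ((signSplit (signVec (cmPlaceOver L) (fun k => Sum.elim (cmGramEntry L e' dV hdV (tensorFrame L dW eW dV') (tensorFrame_real L dW hdW eW dV' hdV')) (-cmGramEntry L e' dV hdV (tensorFrame L dW eW dV') (tensorFrame_real L dW hdW eW dV' hdV')) ((e₂ n').symm k)) (imagUnit L) σ)).symm i)).1,
       signSplit y ((epsD e eW e').symm ((signSplit (signVec (cmPlaceOver L) (fun k => Sum.elim (cmGramEntry L e' dV hdV (tensorFrame L dW eW dV') (tensorFrame_real L dW hdW eW dV' hdV')) (-cmGramEntry L e' dV hdV (tensorFrame L dW eW dV') (tensorFrame_real L dW hdW eW dV' hdV')) ((e₂ n').symm k)) (imagUnit L) σ)).symm i)).2))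
    {P Q : Type} [Fintype P] [DecidableEq P] [Fintype Q] [DecidableEq Q]
    (eSp : P ≃ PosIdx (signVec (cmPlaceOver L) (fun k => Sum.elim (cmGramEntry L e dV hdV dW hdW) (-cmGramEntry L e dV hdV dW hdW) ((e₂ n).symm k)) (imagUnit L) σ))
    (eSq : Q ≃ NegIdx (signVec (cmPlaceOver L) (fun k => Sum.elim (cmGramEntry L e dV hdV dW hdW) (-cmGramEntry L e dV hdV dW hdW) ((e₂ n).symm k)) (imagUnit L) σ))
    (k : Matrix.unitaryGroup (PosIdx y) ℂ × Matrix.unitaryGroup (NegIdx y) ℂ) :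
    partnerEmb L e dV hdV dW hdW eW e' dV' hdV'
        (UnitaryGroup.adelicSingle (Fp L) L (IsCMField.complexConj L) M₂ (Matrix.diagonal dV') (IsCMField.complexConj_ne_one L)
          (complexConj_smul_infinitePlace L) (cmPlaceOver L σ)
          ((toUFormEquiv (signSplit y) (fun j => sqrtAbs_ne_zero (hy j)) one_ne_zero (formCongr_yFrame L dV' hdV' σ y hy hyσ)).symm
            (UForm.kV (PosIdx y) (NegIdx y) k))) =
      K2LiuArchOneParameterOrbitDefs.archEmb (Fp L) L (IsCMField.complexConj L) (n' + n')
          (hermD L e' dV hdV (tensorFrame L dW eW dV') (tensorFrame_real L dW hdW eW dV' hdV'))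
          (placeSecJ L (IsCMField.complexConj L) (n' + n') (IsCMField.complexConj_ne_one L) (cmPlaceOver L) (cmPlaceOver_smul L) _
            (gramD_gram_realDiagonal_entry_ne_zero L e' dV hdV (tensorFrame L dW eW dV') (tensorFrame_real L dW hdW eW dV' hdV') hdV0 (tensorFrame_ne_zero L dW eW dV' hdW0 hdV'0)) (complexConj_imagUnit L) (imagUnit_ne_zero L) σ
            (cmPlaceOver_comap L) (gramD_eq_diagonal_cm L e' dV hdV (tensorFrame L dW eW dV') (tensorFrame_real L dW hdW eW dV' hdV')) (J := hermD L e' dV hdV (tensorFrame L dW eW dV') (tensorFrame_real L dW hdW eW dV' hdV')) rfl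
            (complexConj_smul_infinitePlace L)
            (eP.symm.trans (Equiv.sumCongr (eSp.symm.prodCongr (Equiv.refl (PosIdx y))) (eSq.symm.prodCongr (Equiv.refl (NegIdx y)))))
            (eQ.symm.trans (Equiv.sumCongr (eSp.symm.prodCongr (Equiv.refl (NegIdx y))) (eSq.symm.prodCongr (Equiv.refl (PosIdx y)))))
            ((toBig P Q (PosIdx y) (NegIdx y) (κ P Q (PosIdx y) (NegIdx y) ((1 : Matrix.unitaryGroup P ℂ × Matrix.unitaryGroup Q ℂ), k)), (1 : UForm Unit Empty)) :
              Ginf ((P × PosIdx y) ⊕ (Q × NegIdx y)) ((P × NegIdx y) ⊕ (Q × PosIdx y)) Unit Empty)) := by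
  rw [K2LiuArchOneParameterOrbitDefs.archEmb_eq_archToAdelic, placeSecJ_inl, κ_one_left, relabel_symm_toBig_one eSp eSq eP eQ (UForm.kV (PosIdx y) (NegIdx y) k)]
  exact partnerEmb_kHat L e dV hdV dW hdW eW e' dV' hdV' hdV0 hdW0 hdV'0 σ y hy hyσ hz eP eQ hE (UForm.kV (PosIdx y) (NegIdx y) k)

end Summit.HodgeConjecture.HodgeConjecture.Cruxes.HLiu418.K2LiuArchPlaceSecJPartnerEmb

end
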